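import Summits.BirchSwinnertonDyer.BirchSwinnertonDyer.Theorems.EisensteinDepletionAtTwoStarOptBNSFKummerQExpDictionary
import Summits.BirchSwinnertonDyer.BirchSwinnertonDyer.Theorems.EisensteinDepletionAtTwoStarOptBNSFKummerAlg
import Summits.BirchSwinnertonDyer.BirchSwinnertonDyer.Theorems.EisensteinDepletionAtTwoStarOptBNSFCongruenceCore
import HarnessLib

/-!
# The `q`-expansion identities of the Kummer form (line `nsf` v18, stub S3-Q `stub_kummerQExp`, crux `StarOptBNSF`, stmt-BirchSwinnertonDyer-27047)

**Stub S3-Q CLOSED.**  For `W₁/ℚ` with newform `f`, Néron pair `L₁`, `c₁ ≠ 0`, the formal square root `B` (`B² = X − x₁z²`,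
`X = formalXMulSq W₁`), the integral expansion `z(q) = Σ zqₙqⁿ` of the formal parameter `−x/y` at `c₁u_f(τ)` (S2), cusp forms
`G₁, Φ₁ ∈ S_k(Γ₁(N))` with `Φ₁ = x_{W₁}·G₁` off the poles, and `h ∈ S_k(Γ′)` (`T ∈ Γ′`) with `h² = (Φ₁ − x₁G₁)·G₁`, the Mathlib
`q`-expansions at `∞` satisfy (i) `qExp(Φ₁)·z(q)² = X(z(q))·qExp(G₁)`, (ii) `qExp(h)²·z(q)⁴ = (z·B(z))²(z(q))·qExp(G₁)²`, and
`qExp` is linear.  Method (the GEN 11 Taylor toolkit): every `q`-expansion is the Taylor series at `q = 0` of the cusp function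
(by Mathlib's definition); `z(q) = t(c₁U(q))` with `U(q) = Σ aₙqⁿ/n` (`…ParamExpansion`), whose Taylor series is BOTH `Σ zqₙqⁿ` (from
the S2 `HasSum`, `taylor_eq_mk_of_hasSum`) and `exp_W ∘ (c₁Σaₙqⁿ/n)` (`TaylorComp.taylor_comp`, `taylor_localParam_eq_formalExp`);
the analytic dictionary `x·t² = X(exp_W)` (`taylor_xMulLocalParamSq`); products and composites of Taylor series; and the pointwise
identities read through `cuspFunction` on a small punctured disc where `c₁U(q) ∉ Λ`.
BSD is not proved by this file; nothing here reads `r_an`.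
-/

set_option linter.dupNamespace false
set_option autoImplicit false

noncomputable section

open PowerSeries Filter Set Literature.NumberTheory.Transcendental.AndreCriterion
open scoped Topology Nat Classical PeriodPair

/-- The Taylor series of `f : ℂ → ℂ` at `0` (local notation, as in `AndreCriterionAnalyticProofs`). -/
local notation3 "𝓣[" f "]" =>
  (PowerSeries.mk fun n => ((Nat.factorial n : ℂ)⁻¹ * iteratedDeriv n f 0) : PowerSeries ℂ)

namespace Summit.BirchSwinnertonDyer.BirchSwinnertonDyer.Theorems.DepletionAtTwo.KummerQExp

open Literature.NumberTheory.EllipticCurves Literature.NumberTheory.EllipticCurves.ModularForms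
open Literature.Analysis.Complex.TaylorComp UpperHalfPlane
open scoped MatrixGroups ModularForm
open Summit.BirchSwinnertonDyer.BirchSwinnertonDyer.Theorems.DepletionAtTwo.ParamExpansion
open Summit.BirchSwinnertonDyer.BirchSwinnertonDyer.Theorems.DepletionAtTwo.KummerAlg

/-- The `q`-expansion of Mathlib is the Taylor series of the cusp function (by definition). [folklore] -/
theorem qExpansion_eq_taylor (F : UpperHalfPlane → ℂ) :
    UpperHalfPlane.qExpansion (1 : ℝ) F = 𝓣[UpperHalfPlane.cuspFunction (1 : ℝ) F] := by
  ext n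
  rw [UpperHalfPlane.qExpansion_coeff, coeff_mk]

/-- `1` is a strict period of `Γ₁(N)`. [folklore] -/
theorem one_mem_strictPeriods_gamma1 (N : ℕ) :
    (1 : ℝ) ∈ (CongruenceSubgroup.Gamma1 N : Subgroup (GL (Fin 2) ℝ)).strictPeriods := by
  simp

/-- Linearity of the `q`-expansion of a cusp form in the `fun τ ↦ c * F τ` form. [folklore] -/
theorem qExpansion_const_mul {Γ : Subgroup SL(2, ℤ)} {k : ℤ} (F : CuspForm Γ k)
    (hΓ : (1 : ℝ) ∈ (Γ : Subgroup (GL (Fin 2) ℝ)).strictPeriods) (c : ℂ) :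
    UpperHalfPlane.qExpansion (1 : ℝ) (fun τ : UpperHalfPlane ↦ c * F τ) =
      PowerSeries.C c * UpperHalfPlane.qExpansion (1 : ℝ) F := by
  have ha := ModularFormClass.analyticAt_cuspFunction_zero F one_pos hΓ
  have hfun : (fun τ : UpperHalfPlane ↦ c * F τ) = c • (F : UpperHalfPlane → ℂ) := by
    funext τ; simp
  rw [hfun, UpperHalfPlane.qExpansion_smul ha c, smul_eq_C_mul]

/-- **STUB S3-Q `stub_kummerQExp` of line `nsf` v18 (crux `StarOptBNSF`, stmt-BirchSwinnertonDyer-27047) — registered signature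
verbatim.**  The two `q`-expansion identities (i) `qExp(Φ₁)·z(q)² = X(z(q))·qExp(G₁)`, (ii) `qExp(h)²·z(q)⁴ = (z B(z))²(z(q))·qExp(G₁)²`
and the linearity of `qExp`, from: the expansion `z(q)` of the formal parameter (S2, Taylor series of `t ∘ (c₁U)` both as `Σ zqₙqⁿ`
and as `exp_W(c₁Σaₙqⁿ/n)`), the analytic dictionary `x·t² = X(exp_W)` (`taylor_xMulLocalParamSq`), the Taylor series of a composite
(`TaylorComp.taylor_comp`) and of products, `B² = X − x₁z²`, and the pointwise identities `Φ₁ = xG₁`, `h² = (Φ₁ − x₁G₁)G₁` read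
through Mathlib's `cuspFunction`.  [cite: SilvermanAEC2009, IV.1 and VI.3.6] [cite: CremonaAlgorithms1997, §2.10] -/
theorem stub_kummerQExp :
    ∀ (W₁ : WeierstrassCurve ℚ) [W₁.IsElliptic] [W₁.IsGloballyMinimal]
      ⦃N : ℕ⦄ [NeZero N] (f : CuspForm (CongruenceSubgroup.Gamma0 N) 2), IsNewformOf W₁ f →
      ∀ (L₁ : PeriodPair), IsNeronLatticeOf (W₁.baseChange ℂ) L₁ → ∀ (c₁ : ℚ), c₁ ≠ 0 →
      ∀ (x₁ : ℚ) (B : PowerSeries ℚ), PowerSeries.constantCoeff B = 1 →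
        B ^ 2 = W₁.formalXMulSq - PowerSeries.C x₁ * PowerSeries.X ^ 2 →
      ∀ (zq : PowerSeries ℤ), PowerSeries.constantCoeff zq = 0 → PowerSeries.coeff 1 zq ≠ 0 →
        (∃ A : ℝ, ∀ τ : UpperHalfPlane, A < τ.im →
          HasSum (fun n : ℕ ↦ ((PowerSeries.coeff n zq : ℤ) : ℂ) *
              Complex.exp (2 * Real.pi * Complex.I * (τ : ℂ)) ^ n)
            (-(L₁.weierstrassP ((c₁ : ℂ) * eichlerIntegral f τ) - ((W₁.b₂ : ℚ) : ℂ) / 12) /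
              ((L₁.derivWeierstrassP ((c₁ : ℂ) * eichlerIntegral f τ)
                - ((W₁.a₁ : ℚ) : ℂ) * (L₁.weierstrassP ((c₁ : ℂ) * eichlerIntegral f τ) - ((W₁.b₂ : ℚ) : ℂ) / 12)
                - ((W₁.a₃ : ℚ) : ℂ)) / 2))) →
      ∀ (k : ℤ) (G₁ Φ₁ : CuspForm (CongruenceSubgroup.Gamma1 N) k),
        (∀ τ : UpperHalfPlane, (c₁ : ℂ) * eichlerIntegral f τ ∉ L₁.lattice →
          Φ₁ τ = (L₁.weierstrassP ((c₁ : ℂ) * eichlerIntegral f τ) - ((W₁.b₂ : ℚ) : ℂ) / 12) * G₁ τ) →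
      ∀ (Γ' : Subgroup SL(2, ℤ)), ModularGroup.T ∈ Γ' → ∀ (h : CuspForm Γ' k),
        (∀ τ : UpperHalfPlane, h τ ^ 2 = (Φ₁ τ - ((x₁ : ℚ) : ℂ) * G₁ τ) * G₁ τ) →
      UpperHalfPlane.qExpansion (1 : ℝ) Φ₁ * (PowerSeries.map (Int.castRingHom ℂ) zq) ^ 2 =
          PowerSeries.map (algebraMap ℚ ℂ) (W₁.formalXMulSq.subst (PowerSeries.map (Int.castRingHom ℚ) zq)) *
            UpperHalfPlane.qExpansion (1 : ℝ) G₁ ∧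
      UpperHalfPlane.qExpansion (1 : ℝ) h ^ 2 * (PowerSeries.map (Int.castRingHom ℂ) zq) ^ 4 =
          (PowerSeries.map (algebraMap ℚ ℂ)
            (PowerSeries.map (Int.castRingHom ℚ) zq * B.subst (PowerSeries.map (Int.castRingHom ℚ) zq))) ^ 2 *
            UpperHalfPlane.qExpansion (1 : ℝ) G₁ ^ 2 ∧
      (∀ c : ℂ, UpperHalfPlane.qExpansion (1 : ℝ) (fun τ : UpperHalfPlane ↦ c * h τ) =
          PowerSeries.C c * UpperHalfPlane.qExpansion (1 : ℝ) h) ∧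
      (∀ c : ℂ, UpperHalfPlane.qExpansion (1 : ℝ) (fun τ : UpperHalfPlane ↦ c * Φ₁ τ) =
          PowerSeries.C c * UpperHalfPlane.qExpansion (1 : ℝ) Φ₁) := by
  intro W₁ _ _ N _ f hf L₁ hL₁ c₁ hc₁ x₁ B hB0 hBsq zq hz0 hz1 hzsum k G₁ Φ₁ hΦ Γ' hT h hh2
  obtain ⟨A, hA⟩ := hzsum
  have hΓ1 := one_mem_strictPeriods_gamma1 N
  have hΓ' := Summit.BirchSwinnertonDyer.BirchSwinnertonDyer.Theorems.DepletionAtTwo.CongruenceCore.one_mem_strictPeriods_of_T_mem hT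
  ------------------------------------------------------------------
  -- the curve over `ℂ` and its coefficient casts
  ------------------------------------------------------------------
  set W : WeierstrassCurve ℂ := W₁.baseChange ℂ with hW
  have hb₂ : W.b₂ = ((W₁.b₂ : ℚ) : ℂ) := by
    simp [hW, WeierstrassCurve.baseChange, WeierstrassCurve.map_b₂, eq_ratCast]
  have ha₁ : W.a₁ = ((W₁.a₁ : ℚ) : ℂ) := by
    simp [hW, WeierstrassCurve.baseChange, WeierstrassCurve.map_a₁, eq_ratCast]
  have ha₃ : W.a₃ = ((W₁.a₃ : ℚ) : ℂ) := by
    simp [hW, WeierstrassCurve.baseChange, WeierstrassCurve.map_a₃, eq_ratCast]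
  -- the local parameter `t` and `ξ = x·t²` along the uniformisation of `(W, L₁)`
  set t : ℂ → ℂ := fun z ↦ if z ∈ L₁.lattice then (0 : ℂ) else
    -(℘[L₁] z - W.b₂ / 12) / ((℘'[L₁] z - W.a₁ * (℘[L₁] z - W.b₂ / 12) - W.a₃) / 2) with ht
  set ξ : ℂ → ℂ := fun z ↦ if z ∈ L₁.lattice then (1 : ℂ) else
    (℘[L₁] z - W.b₂ / 12) * (-(℘[L₁] z - W.b₂ / 12) /
      ((℘'[L₁] z - W.a₁ * (℘[L₁] z - W.b₂ / 12) - W.a₃) / 2)) ^ 2 with hξ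
  have hta : AnalyticAt ℂ t 0 := (WeierstrassCurve.analyticAt_localParam L₁ W).1
  have hξa : AnalyticAt ℂ ξ 0 := analyticAt_xMulLocalParamSq L₁ W
  have hTt : 𝓣[t] = W.formalExp := WeierstrassCurve.taylor_localParam_eq_formalExp L₁ W hL₁.1 hL₁.2
  have hTξ : 𝓣[ξ] = W.formalXMulSq.subst W.formalExp := taylor_xMulLocalParamSq L₁ W hL₁.1 hL₁.2
  have ht0 : t 0 = 0 := by rw [ht]; exact if_pos (zero_mem _)
  have hξ0 : ξ 0 = 1 := by rw [hξ]; exact if_pos (zero_mem _)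
  have htz : ∀ z, z ∉ L₁.lattice →
      t z = -(℘[L₁] z - W.b₂ / 12) / ((℘'[L₁] z - W.a₁ * (℘[L₁] z - W.b₂ / 12) - W.a₃) / 2) :=
    fun z hz ↦ by rw [ht]; exact if_neg hz
  have hξz : ∀ z, z ∉ L₁.lattice → ξ z = (℘[L₁] z - W.b₂ / 12) * t z ^ 2 := fun z hz ↦ by
    rw [hξ, htz z hz]; exact if_neg hz
  ------------------------------------------------------------------
  -- the `q`-series `U` of the Eichler integral and `X = c₁U`
  ------------------------------------------------------------------
  set b : ℕ → ℂ := fun n ↦ cuspCoeff f n / n with hb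
  set U : ℂ → ℂ := fun q ↦ ∑' n : ℕ, cuspCoeff f n / n * q ^ n with hU
  have hUsum : ∀ q : ℂ, ‖q‖ < 1 → HasSum (fun n ↦ b n * q ^ n) (U q) := fun q hq ↦
    hasSum_eichlerSeries f q hq
  have hb1 : b 1 ≠ 0 := by simp [hb, hf.2 1, WeierstrassCurve.LFunction_apply_one]
  have hU0 : U 0 = 0 := by rw [apply_zero_of_hasSum one_pos hUsum]; simp [hb]
  set X : ℂ → ℂ := fun q ↦ (c₁ : ℂ) * U q with hX
  have hUa : AnalyticAt ℂ U 0 := analyticAt_of_hasSum one_pos hUsum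
  have hXa : AnalyticAt ℂ X 0 := analyticAt_const.mul hUa
  have hX0 : X 0 = 0 := by simp [hX, hU0]
  have hTU : 𝓣[U] = PowerSeries.mk b := taylor_eq_mk_of_hasSum one_pos hUsum
  have hTX : 𝓣[X] = C (c₁ : ℂ) * PowerSeries.mk b := by rw [hX, taylor_const_mul, hTU]
  have hTX0 : constantCoeff 𝓣[X] = 0 := by rw [constantCoeff_taylor, hX0]
  have hsX : HasSubst 𝓣[X] := HasSubst.of_constantCoeff_zero' hTX0
  have hsE : HasSubst W.formalExp := HasSubst.of_constantCoeff_zero' W.constantCoeff_formalExp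
  -- `z̃ = t ∘ X` and its two Taylor descriptions
  have htXa : AnalyticAt ℂ (t ∘ X) 0 := by
    have : AnalyticAt ℂ t (X 0) := by rw [hX0]; exact hta
    exact this.comp hXa
  have hTz : 𝓣[t ∘ X] = W.formalExp.subst 𝓣[X] := by rw [taylor_comp hta hXa hX0, hTt]
  ------------------------------------------------------------------
  -- a ball around `q = 0` on which everything is defined by the formulas
  ------------------------------------------------------------------
  have hXtend : Tendsto X (𝓝 0) (𝓝 0) := by
    have := hXa.continuousAt.tendsto; rwa [hX0] at this
  have hE2 : ∀ᶠ q in 𝓝 (0 : ℂ), q ≠ 0 → U q ≠ 0 :=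
    eventually_nhdsWithin_iff.mp (eventually_ne_zero_of_hasSum one_pos hUsum hb1)
  have hE3 : ∀ᶠ q in 𝓝 (0 : ℂ), X q ∈ (L₁.lattice \ {(0 : ℂ)} : Set ℂ)ᶜ :=
    hXtend.eventually (L₁.compl_lattice_sdiff_singleton_mem_nhds 0)
  have hE4 : ∀ᶠ q in 𝓝 (0 : ℂ), ‖q‖ < min 1 (Real.exp (-2 * Real.pi * A)) := by
    have hpos : 0 < min 1 (Real.exp (-2 * Real.pi * A)) := lt_min one_pos (Real.exp_pos _)
    have : Metric.ball (0 : ℂ) (min 1 (Real.exp (-2 * Real.pi * A))) ∈ 𝓝 (0 : ℂ) :=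
      Metric.ball_mem_nhds 0 hpos
    filter_upwards [this] with q hq
    simpa using hq
  obtain ⟨ρ, hρ0, hρ⟩ := Metric.eventually_nhds_iff_ball.mp (hE2.and (hE3.and hE4))
  -- on the punctured ball: a point `τ_q` of `ℍ` with `𝕢 1 τ_q = q`, `Im τ_q > A`, `u_f(τ_q) = U q`, `X q ∉ Λ`
  have hball : ∀ q : ℂ, ‖q‖ < ρ → q ≠ 0 →
      ∃ τ : UpperHalfPlane, Function.Periodic.qParam 1 (τ : ℂ) = q ∧ A < τ.im ∧
        eichlerIntegral f τ = U q ∧ X q ∉ L₁.lattice ∧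
        Complex.exp (2 * Real.pi * Complex.I * (τ : ℂ)) = q := by
    intro q hq hq0
    obtain ⟨hq2, hq3, hq4⟩ := hρ q (by simpa using hq)
    have hq1 : ‖q‖ < 1 := lt_of_lt_of_le hq4 (min_le_left _ _)
    have hqA : ‖q‖ < Real.exp (-2 * Real.pi * A) := lt_of_lt_of_le hq4 (min_le_right _ _)
    set τ₀ : ℂ := Function.Periodic.invQParam 1 q with hτ₀
    have him : 0 < τ₀.im := by
      rw [hτ₀, Function.Periodic.im_invQParam]
      have hlog : Real.log ‖q‖ < 0 := Real.log_neg (norm_pos_iff.mpr hq0) hq1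
      have hneg : -(1 : ℝ) / (2 * Real.pi) < 0 := by
        rw [neg_div]; exact neg_neg_of_pos (by positivity)
      exact mul_pos_of_neg_of_neg hneg hlog
    refine ⟨⟨τ₀, him⟩, Function.Periodic.qParam_right_inv one_ne_zero hq0, ?_, ?_, ?_, ?_⟩
    · -- `A < Im τ_q` from `‖q‖ < e^{-2πA}`
      have h := (Function.Periodic.norm_qParam_lt_iff one_pos A τ₀).mp (by
        rw [Function.Periodic.qParam_right_inv one_ne_zero hq0, div_one]; exact hqA)
      exact h
    · rw [eichlerIntegral_eq_tsum f ⟨τ₀, him⟩]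
      show ∑' n : ℕ, cuspCoeff f n / n * Function.Periodic.qParam 1 τ₀ ^ n = U q
      rw [Function.Periodic.qParam_right_inv one_ne_zero hq0]
    · intro hmem
      have hne : X q ≠ 0 := mul_ne_zero (by exact_mod_cast hc₁) (hq2 hq0)
      exact hq3 ⟨hmem, hne⟩
    · have := Function.Periodic.qParam_right_inv (h := 1) one_ne_zero hq0
      rw [Function.Periodic.qParam] at this
      simpa using this
  ------------------------------------------------------------------
  -- `𝓣[t ∘ X] = zq` (the S2 expansion) : `HasSum (zqₙ qⁿ) (t (X q))` on the ball
  ------------------------------------------------------------------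
  have hzsum' : ∀ q : ℂ, ‖q‖ < ρ →
      HasSum (fun n ↦ ((PowerSeries.coeff n zq : ℤ) : ℂ) * q ^ n) ((t ∘ X) q) := by
    intro q hq
    by_cases hq0 : q = 0
    · subst hq0
      have h2 : HasSum (fun n : ℕ ↦ ((PowerSeries.coeff n zq : ℤ) : ℂ) * (0 : ℂ) ^ n)
          (((PowerSeries.coeff 0 zq : ℤ) : ℂ) * (0 : ℂ) ^ 0) :=
        hasSum_single 0 fun n hn ↦ by simp [hn]
      rw [pow_zero, mul_one, PowerSeries.coeff_zero_eq_constantCoeff, hz0, Int.cast_zero] at h2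
      rwa [Function.comp_apply, hX0, ht0]
    · obtain ⟨τ, hqτ, hAτ, hUτ, hXΛ, hexpq⟩ := hball q hq hq0
      have h := hA τ hAτ
      rw [hexpq] at h
      rw [Function.comp_apply, htz _ hXΛ, hX]
      dsimp only
      rw [← hUτ, hb₂, ha₁, ha₃]
      exact h
  have hTz' : 𝓣[t ∘ X] = PowerSeries.map (Int.castRingHom ℂ) zq := by
    rw [taylor_eq_mk_of_hasSum hρ0 hzsum']
    ext n
    rw [coeff_mk, coeff_map, eq_intCast]
  ------------------------------------------------------------------
  -- the cusp functions of `Φ₁`, `G₁`, `h`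
  ------------------------------------------------------------------
  have hΦa := ModularFormClass.analyticAt_cuspFunction_zero Φ₁ one_pos hΓ1
  have hGa := ModularFormClass.analyticAt_cuspFunction_zero G₁ one_pos hΓ1
  have hha := ModularFormClass.analyticAt_cuspFunction_zero h one_pos hΓ'
  have hG00 : UpperHalfPlane.cuspFunction 1 G₁ 0 = 0 := CuspFormClass.cuspFunction_apply_zero G₁ one_pos hΓ1
  have hΦv : ∀ τ : UpperHalfPlane, UpperHalfPlane.cuspFunction 1 Φ₁ (Function.Periodic.qParam 1 (τ : ℂ)) = Φ₁ τ :=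
    fun τ ↦ SlashInvariantFormClass.eq_cuspFunction Φ₁ τ hΓ1 one_ne_zero
  have hGv : ∀ τ : UpperHalfPlane, UpperHalfPlane.cuspFunction 1 G₁ (Function.Periodic.qParam 1 (τ : ℂ)) = G₁ τ :=
    fun τ ↦ SlashInvariantFormClass.eq_cuspFunction G₁ τ hΓ1 one_ne_zero
  have hhv : ∀ τ : UpperHalfPlane, UpperHalfPlane.cuspFunction 1 h (Function.Periodic.qParam 1 (τ : ℂ)) = h τ :=
    fun τ ↦ SlashInvariantFormClass.eq_cuspFunction h τ hΓ' one_ne_zero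
  have hballmem : ∀ᶠ q in 𝓝 (0 : ℂ), ‖q‖ < ρ := by
    filter_upwards [Metric.ball_mem_nhds (0 : ℂ) hρ0] with q hq
    simpa using hq
  ------------------------------------------------------------------
  -- map bookkeeping `ℚ → ℂ`
  ------------------------------------------------------------------
  have hXmap : W.formalXMulSq = PowerSeries.map (algebraMap ℚ ℂ) W₁.formalXMulSq := by
    rw [WeierstrassCurve.map_formalXMulSq]; rfl
  have hzQ0 : constantCoeff (PowerSeries.map (Int.castRingHom ℚ) zq) = 0 := by
    rw [constantCoeff_map', hz0, map_zero]
  refine ⟨?_, ?_, qExpansion_const_mul h hΓ', qExpansion_const_mul Φ₁ hΓ1⟩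
  ------------------------------------------------------------------
  -- (i) `qExp(Φ₁)·z² = X(z)·qExp(G₁)`
  ------------------------------------------------------------------
  · have hF : (UpperHalfPlane.cuspFunction 1 Φ₁ * (t ∘ X) ^ 2) =ᶠ[𝓝 0]
        ((ξ ∘ X) * UpperHalfPlane.cuspFunction 1 G₁) := by
      filter_upwards [hballmem] with q hq
      simp only [Pi.mul_apply, Pi.pow_apply, Function.comp_apply]
      by_cases hq0 : q = 0
      · subst hq0
        rw [hX0, ht0, hξ0, hG00]; ring
      · obtain ⟨τ, hqτ, -, hUτ, hXΛ, -⟩ := hball q hq hq0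
        have e1 : UpperHalfPlane.cuspFunction 1 Φ₁ q = Φ₁ τ := by rw [← hqτ]; exact hΦv τ
        have e2 : UpperHalfPlane.cuspFunction 1 G₁ q = G₁ τ := by rw [← hqτ]; exact hGv τ
        have hXq : X q = (c₁ : ℂ) * eichlerIntegral f τ := by simp only [hX, hUτ]
        rw [e1, e2, hΦ τ (by rw [← hXq]; exact hXΛ), hξz _ hXΛ, hXq, hb₂]
        ring
    have h1 : 𝓣[UpperHalfPlane.cuspFunction 1 Φ₁ * (t ∘ X) ^ 2] =
        𝓣[UpperHalfPlane.cuspFunction 1 Φ₁] * 𝓣[t ∘ X] ^ 2 := by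
      rw [taylor_mul hΦa (htXa.pow 2), taylor_pow htXa 2]
    have hξXa : AnalyticAt ℂ (ξ ∘ X) 0 := by
      have : AnalyticAt ℂ ξ (X 0) := by rw [hX0]; exact hξa
      exact this.comp hXa
    have h2 : 𝓣[(ξ ∘ X) * UpperHalfPlane.cuspFunction 1 G₁] =
        (W.formalXMulSq.subst (PowerSeries.map (Int.castRingHom ℂ) zq)) * 𝓣[UpperHalfPlane.cuspFunction 1 G₁] := by
      rw [taylor_mul hξXa hGa, taylor_comp hξa hXa hX0, hTξ, PowerSeries.subst_comp_subst_apply hsE hsX,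
        ← hTz, hTz']
    rw [qExpansion_eq_taylor, qExpansion_eq_taylor, ← hTz', ← h1, taylor_congr hF, h2, hXmap,
      map_rat_subst hzQ0, map_rat_map_int]
  ------------------------------------------------------------------
  -- (ii) `qExp(h)²·z⁴ = (zB(z))²·qExp(G₁)²`
  ------------------------------------------------------------------
  · set ψ : ℂ → ℂ := fun w ↦ ξ w * t w ^ 2 - ((x₁ : ℚ) : ℂ) * t w ^ 4 with hψ
    have hψa : AnalyticAt ℂ ψ 0 := by
      rw [hψ]
      exact (hξa.mul (hta.pow 2)).sub (analyticAt_const.mul (hta.pow 4))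
    have hTψ : 𝓣[ψ] = ((PowerSeries.X * PowerSeries.map (algebraMap ℚ ℂ) B) ^ 2).subst W.formalExp := by
      have hfun : ψ = ξ * t ^ 2 - (fun _ : ℂ ↦ ((x₁ : ℚ) : ℂ)) * t ^ 4 := by
        funext w; simp [hψ]
      have hBC : (PowerSeries.map (algebraMap ℚ ℂ) B) ^ 2 =
          W.formalXMulSq - C ((x₁ : ℚ) : ℂ) * PowerSeries.X ^ 2 := by
        rw [← map_pow, hBsq, map_sub, map_mul, map_pow, map_C, map_X, hXmap, eq_ratCast]
      rw [hfun, taylor_sub (hξa.mul (hta.pow 2)) (analyticAt_const.mul (hta.pow 4)),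
        taylor_mul hξa (hta.pow 2), taylor_mul analyticAt_const (hta.pow 4), taylor_const, taylor_pow hta 2,
        taylor_pow hta 4, hTξ, hTt, mul_pow, hBC, ← coe_substAlgHom hsE, map_mul, map_pow, substAlgHom_X, map_sub,
        map_mul, map_pow, substAlgHom_X, substAlgHom_C]
      ring
    have hF : (UpperHalfPlane.cuspFunction 1 h ^ 2 * (t ∘ X) ^ 4) =ᶠ[𝓝 0]
        ((ψ ∘ X) * UpperHalfPlane.cuspFunction 1 G₁ ^ 2) := by
      filter_upwards [hballmem] with q hq
      simp only [Pi.mul_apply, Pi.pow_apply, Function.comp_apply]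
      by_cases hq0 : q = 0
      · subst hq0
        rw [hX0, ht0, hG00]; ring
      · obtain ⟨τ, hqτ, -, hUτ, hXΛ, -⟩ := hball q hq hq0
        have e1 : UpperHalfPlane.cuspFunction 1 h q = h τ := by rw [← hqτ]; exact hhv τ
        have e2 : UpperHalfPlane.cuspFunction 1 G₁ q = G₁ τ := by rw [← hqτ]; exact hGv τ
        have hXq : X q = (c₁ : ℂ) * eichlerIntegral f τ := by simp only [hX, hUτ]
        rw [e1, e2, hh2 τ, hΦ τ (by rw [← hXq]; exact hXΛ), hψ]
        dsimp only
        rw [hξz _ hXΛ, hXq, hb₂]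
        ring
    have h1 : 𝓣[UpperHalfPlane.cuspFunction 1 h ^ 2 * (t ∘ X) ^ 4] =
        𝓣[UpperHalfPlane.cuspFunction 1 h] ^ 2 * 𝓣[t ∘ X] ^ 4 := by
      rw [taylor_mul (hha.pow 2) (htXa.pow 4), taylor_pow hha 2, taylor_pow htXa 4]
    have hψXa : AnalyticAt ℂ (ψ ∘ X) 0 := by
      have : AnalyticAt ℂ ψ (X 0) := by rw [hX0]; exact hψa
      exact this.comp hXa
    have hsz : HasSubst (PowerSeries.map (Int.castRingHom ℂ) zq) :=
      HasSubst.of_constantCoeff_zero' (by rw [constantCoeff_map', hz0, map_zero])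
    have h2 : 𝓣[(ψ ∘ X) * UpperHalfPlane.cuspFunction 1 G₁ ^ 2] =
        (PowerSeries.map (Int.castRingHom ℂ) zq *
            (PowerSeries.map (algebraMap ℚ ℂ) B).subst (PowerSeries.map (Int.castRingHom ℂ) zq)) ^ 2 *
          𝓣[UpperHalfPlane.cuspFunction 1 G₁] ^ 2 := by
      rw [taylor_mul hψXa (hGa.pow 2), taylor_pow hGa 2, taylor_comp hψa hXa hX0, hTψ,
        PowerSeries.subst_comp_subst_apply hsE hsX, ← hTz, hTz', ← coe_substAlgHom hsz, map_pow, map_mul,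
        substAlgHom_X, coe_substAlgHom]
    rw [qExpansion_eq_taylor, qExpansion_eq_taylor, ← hTz', ← h1, taylor_congr hF, h2, map_mul, map_rat_map_int,
      map_rat_subst hzQ0, map_rat_map_int]

end Summit.BirchSwinnertonDyer.BirchSwinnertonDyer.Theorems.DepletionAtTwo.KummerQExp

end
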